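/-
Copyright (c) 2026 the pub-hodgecm-mathlib formalisation cell (harness21).  U2H assembler seat hodgecm-mathlib-LH4-p03 (g11) (heir LEAD F0P3a-plan T17-31 (R-9); dealer LH4-plan
(g10) WORD #12 «`hFamily` = DEFS LEAF №5, yours»; desk INVENTORY-TIER1 v1 §U2H «DEF hFamily»).  2026-09-03.
-/
import Summits.HodgeConjecture.HodgeConjecture.Theorems.F0P3cDyRamFourFrameHSideDefs   -- ★ №2c (p854644): (D-CΔ), (D-H) and the H-side ★ vocabulary (`cmDatum`, `cmLocalIntegralLevel`, `localNonsplitEquiv`, `placeForm`)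
import HarnessLib

/-!
# F0 · P3c · line «(D-RAM) FOUR-FRAME» — DEFS LEAF №5 «H-FAMILY»: the explicit H-side test family `hFamily = ![1_{K_H⁰ × U₁}, 1_{K_H♯ × U₁}]` of unit (ii-H)

Cell `pub/hodgecm-mathlib`, crux H413 = `stmt-HodgeConjecture-24833` (helper lane `--supports stmt-HodgeConjecture-24833 --as helper`), route HCCMUnconditional; tier-1 unit
`U2H_HSide` (assembler LH4-p03 (g11)); dealer LH4-plan (g10) WORD #12; desk INVENTORY-TIER1 v1 56a02b7f4f575bad §U2H «DEF `hFamily` (no stub): the finite family ψ_s ∈ C_c^∞(H(F_v)),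
as an explicit object (indicator combinations on the U(1,1) × U(1) side)».  DEF LANE: `def`s ONLY (no theorem, no instance, no notation, no `sorry`, no named fact, no `set_option`).
WHY A TREE MODULE (T11-93 ∕ LEAD (R-6)(a) «rows share ψ»): (D-H) `HSideAnchorRows` exports ONE `(r, ψ, coef)` per anchor piece for all three population rows; to cut U2H into
per-row ∕ per-profile stubs (desk rows `hFamily_smooth_compact`, `stableOI_H_edgeBall`, `ampl_identity`, `rows23_passThrough`, `family_consistency`) the family must have a NAME
that separate `theorem`s can share — this leaf gives it one.

THE OBJECT (the WILD twin of the TAME-RAMIFIED profiles `ψ^ram = ![χ⁰, χ♯]` of ★ `Literature/NumberTheory/Rogawski1990/DepthZeroTransferHValuesTypeOneRamified.lean`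
(F0P2-p06 (g12), «O8c-ram»), same spelling, NO `σ_w ϖ = −ϖ`, NO `|2| = 1`).  `H_v = U(Φ₂)(L⁺_v) × U(Φ₁)(L⁺_v)` (★ `cmDatum L 2 Φ₂ ∕ cmDatum L 1 Φ₁`, `Local v`), `w ∣ v` the
non-split place, `ϖ` a uniformiser of `L_w` (a binder — only its valuation matters):
* `hProfileZero L v = 1_{K_H}`, `K_H = K₂ × K₁` the INTEGRAL level (★ `cmLocalIntegralLevel L 2 Φ₂ v × cmLocalIntegralLevel L 1 Φ₁ v`; `K₂ = Stab(𝒪_w²)`, the self-dual EVEN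
  vertex of the `U(Φ₂)` building — `Φ₂ = antidiag(1,1)` is the hyperbolic plane, even unimodular at every place, wild included);
* `hProfileSharp L v w hw ϖ = 1_{K♯ × U₁}`, `K♯ = U(Φ₂) ∩ D_ϖ GL₂(𝒪_w) D_ϖ⁻¹ = Stab(𝒪_w e₁ ⊕ 𝔭_w e₂)` spelled as the tame file spells it — `{h | ∀ a b, |ϖ^b ϖ^{−a} (h_{2,w})_{ab}|_w ≤ 1}`
  (★ `coe_mem_map_conj_glDiagonal_iff_forall_v_le_one` is the tame dictionary) — the `ϖ`-MODULAR EVEN vertex (`𝒪e₁ ⊕ 𝔭e₂` has Gram `antidiag(ϖ, σϖ)`: modular and even at every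
  ramified place); independent of the choice of `ϖ` (units of `𝒪_w` do not move the set);
* `hFamily L v w hw ϖ : Fin 2 → (H_v → ℂ) = ![hProfileZero, hProfileSharp]` — the `(r := 2, ψ)` that U2H's row stubs share; the coefficients `coef : Fin 2 → ℂ` stay a binder of
  the stubs until the H-side census (desk row `stableOI_H_edgeBall`: «2 × B-level edge ball», memo v1.4 4b231cd3d1b58b69 §5) fixes their closed form.
Nothing is asserted: whether THIS family realises (D-H) `HSideAnchorRows depthOfRecord tauOfRecord 0` is exactly U2H's stub `stub_U2H_hSideAnchorRows_unit0` (a PROVER TARGET);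
if the wild H-side census wants other profiles (e.g. deeper level pieces on the `U(1,1)` side at R-P depth), v2 of this leaf ADDS them under new names (append-only).
HONEST LABEL: HC_CM is proved only modulo the 7 printed citations (2 remaining: hLiu418 = stmt-HodgeConjecture-24832, h413 = stmt-HodgeConjecture-24833) until rung 0 closes;
count-neutral vehicle (desk (P-1) «+0»).

## References
* [Rogawski1990] J. D. Rogawski, *Automorphic Representations of Unitary Groups in Three Variables*, Ann. of Math. Stud. 123 (1990): §4.9 Lemma 4.9.3 p. 56, Prop. 4.9.1 (b)
  p. 55 (the `H`-side of the transfer at the identity); §3.9–§3.10 (ramified unitary groups, the two special vertex types).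
* [LabesseLanglands1979] J.-P. Labesse, R. P. Langlands, *L-indistinguishability for SL(2)*, Canad. J. Math. 31 (1979): §2 Lemma 2.1 (the ramified torus), §5.
-/

noncomputable section

namespace Summit.HodgeConjecture.HodgeConjecture.Cruxes.H413.F0P3cDyRamFourFrameHFamilyDefs

open MeasureTheory Measure NumberField IsDedekindDomain Topology Filter
open Literature.NumberTheory.Automorphic Literature.NumberTheory.Automorphic.UnitaryGroup Literature.NumberTheory.Automorphic.IntegralReduction
open Literature.NumberTheory.Rogawski1990 Literature.NumberTheory.GaloisRepresentations
open scoped Matrix MatrixGroups Classical ValuativeRel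

/-- **`hProfileZero L v = 1_{K_H}`** — the indicator of the INTEGRAL level `K_H = K₂ × K₁` of `H_v = U(Φ₂)(L⁺_v) × U(Φ₁)(L⁺_v)` (★ `cmLocalIntegralLevel`; `K₂ = Stab(𝒪_w²)`, the
self-dual even vertex of the `U(Φ₂)` building).  The wild twin of the tame profile `χ⁰` (there cut by a residually-unipotent clause that is `= 1_{K_H}` on the stable orbit,
★ `sq_redMat_sub_one_eq_zero_of_isLocalStablyConjH`; here the plain indicator).  A definition; nothing asserted. -/
def hProfileZero (L : Type) [Field L] [NumberField L] [IsCMField L] (v : HeightOneSpectrum (𝓞 ↥(maximalRealSubfield L))) :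
    ((UnitaryGroup.cmDatum L 2 (Matrix.of fun i j : Fin 2 => if i.val + j.val + 1 = 2 then (1 : L) else 0)).Local v ×
      (UnitaryGroup.cmDatum L 1 (Matrix.of fun i j : Fin 1 => if i.val + j.val + 1 = 1 then (1 : L) else 0)).Local v) → ℂ :=
  Set.indicator
    (((cmLocalIntegralLevel L 2 (Matrix.of fun i j : Fin 2 => if i.val + j.val + 1 = 2 then (1 : L) else 0) v).prod
        (cmLocalIntegralLevel L 1 (Matrix.of fun i j : Fin 1 => if i.val + j.val + 1 = 1 then (1 : L) else 0) v) : Subgroup _) : Set _)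
    (fun _ => (1 : ℂ))

/-- **`hProfileSharp L v w hw ϖ = 1_{K♯ × U₁}`** — the indicator of the stabiliser `K♯ = U(Φ₂) ∩ D_ϖ GL₂(𝒪_w) D_ϖ⁻¹` of the `ϖ`-MODULAR even vertex `𝒪_w e₁ ⊕ 𝔭_w e₂` of the
`U(Φ₂)` building (times all of `U(Φ₁)`), in the tame file's set-builder spelling `{h | ∀ a b, |ϖ^b · ϖ^{−a} · (h_{2,w})_{ab}|_w ≤ 1}` through ★ `localNonsplitEquiv` at `w`
(`hw : c • w = w`).  Independent of the uniformiser `ϖ` chosen.  The wild twin of the tame profile `χ♯`.  A definition; nothing asserted. -/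
def hProfileSharp (L : Type) [Field L] [NumberField L] [IsCMField L] {v : HeightOneSpectrum (𝓞 ↥(maximalRealSubfield L))}
    (w : UnitaryGroup.PlacesOver L v) (hw : IsCMField.complexConj L • w.1 = w.1) (ϖ : w.1.adicCompletion L) :
    ((UnitaryGroup.cmDatum L 2 (Matrix.of fun i j : Fin 2 => if i.val + j.val + 1 = 2 then (1 : L) else 0)).Local v ×
      (UnitaryGroup.cmDatum L 1 (Matrix.of fun i j : Fin 1 => if i.val + j.val + 1 = 1 then (1 : L) else 0)).Local v) → ℂ :=
  Set.indicator
    {h | ∀ a b : Fin 2, Valued.v (ϖ ^ (b : ℕ) * (ϖ ^ (a : ℕ))⁻¹ *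
        (((localNonsplitEquiv (IsCMField.complexConj L) (Matrix.of fun i j : Fin 2 => if i.val + j.val + 1 = 2 then (1 : L) else 0)
              (IsCMField.complexConj_ne_one L) w hw h.1 :
            ↥(unitaryGroupOfForm (galAdicCompletionMap (L := L) (IsCMField.complexConj L) hw)
                (placeForm (Matrix.of fun i j : Fin 2 => if i.val + j.val + 1 = 2 then (1 : L) else 0) w.1))) :
            GL (Fin 2) (w.1.adicCompletion L)) : Matrix (Fin 2) (Fin 2) (w.1.adicCompletion L)) a b) ≤ 1}
    (fun _ => (1 : ℂ))

/-- **`hFamily L v w hw ϖ = ![hProfileZero, hProfileSharp]`** — THE EXPLICIT H-SIDE TEST FAMILY of unit (ii-H) (`r = 2`): the two vertex-type profiles of the `U(Φ₂) × U(Φ₁)`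
side, the wild twin of ★ `ψ^ram = ![χ⁰, χ♯]`.  U2H's row stubs quantify a coefficient vector `coef : Fin 2 → ℂ` against THIS family; the (D-H) export
`HSideAnchorRows N₀ τ 0` is then witnessed with `(r, ψ) := (2, hFamily …)`.  A definition; nothing asserted (whether it suffices is `stub_U2H_hSideAnchorRows_unit0`). -/
def hFamily (L : Type) [Field L] [NumberField L] [IsCMField L] {v : HeightOneSpectrum (𝓞 ↥(maximalRealSubfield L))}
    (w : UnitaryGroup.PlacesOver L v) (hw : IsCMField.complexConj L • w.1 = w.1) (ϖ : w.1.adicCompletion L) :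
    Fin 2 → (((UnitaryGroup.cmDatum L 2 (Matrix.of fun i j : Fin 2 => if i.val + j.val + 1 = 2 then (1 : L) else 0)).Local v ×
      (UnitaryGroup.cmDatum L 1 (Matrix.of fun i j : Fin 1 => if i.val + j.val + 1 = 1 then (1 : L) else 0)).Local v) → ℂ) :=
  ![hProfileZero L v, hProfileSharp L w hw ϖ]

end Summit.HodgeConjecture.HodgeConjecture.Cruxes.H413.F0P3cDyRamFourFrameHFamilyDefs

end
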